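import Summits.QuantumFields.YangMills.Theorems.UnitScaleTiltFluctuationComparisonRegPrGlobalSlackCanonicalEndToEnd
import Summits.QuantumFields.YangMills.Theorems.UnitScaleTiltFluctuationComparisonRegPrGlobalSlackCanonicalPolymersVolumeC
import Summits.QuantumFields.YangMills.Theorems.UnitScaleTiltFluctuationComparisonRegPrGlobalSlackCanonicalPolymersTermSizeC
import Summits.QuantumFields.YangMills.Theorems.UnitScaleTiltFluctuationComparisonRegPrGlobalSlackLocalToGlobalCount
import HarnessLib

/-!
# `UnitScaleTiltFluctuationComparisonRegPrGlobalSlackCanonicalEndToEndC` — STUB 3⁗ FROM THE SIX CHART ROWS AT THE CANONICAL POLYMERISATION WITH NO LETTER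
# ON THE CONSTANTS RECORD (crux `FluctuationComparisonRegPrIntL`, stmt-QuantumFields-20520 — formerly 19935 —, STUB 3⁗ `stub_globalTwoRunSlackFam`, text
# byte-identical in v5j‴/v5k; width-lever lane A, capstone; OWNER ym3-torus-plan g22 RULING №5 §C ask W-slack-1 ANSWERED TREE-SIDE)

Seat ym-ust-19935-slack g2 (prover).  g0's capstone `K1aChartRows L 𝔠 a₀ a₁ a` (p538799) carries, next to the six chart rows, two located letters on the
record: `L ≤ 𝔠.M₁` (producer rows 3 and 5) and `κ₀(32,6) ≤ κ ≤ 𝔠.κ`, `0 < κ` (row 2).  Since 3⁗ quantifies over EVERY record `𝔠`, the letter `L ≤ M₁` made the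
chart-rows route to 3⁗ partial (records with `M₁ < L` excluded) unless the record is revised (RULING №5 §C (ii)).  This file removes both letters TREE-SIDE:

* `L ≤ M₁`: rows 3 and 5 are re-proved with honest constants — `…CanonicalPolymersVolumeC.volWeight_mul_pow_le_sum_indicator_canon` (volume weight
  `min 1 (M₁/L)³`) and `…CanonicalPolymersTermSizeC.termSizeTrivT_canon'` (constant `× e^{κ₁L³}`) — and the producer is re-run over the count
  (`GlobalSlackLocalToGlobalCount.globalTwoRunSlackTail_of_polymerSlack_volC`); the price `(L/M₁)³ ∨ 1` lands in 3⁗'s `∃ C`;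
* `κ`: the record's own `AlphaConsts.kappa_ge : κ₀(32,6) + 1 ≤ 𝔠.κ` makes `κ := 𝔠.κ` admissible.

CONTENT.  §1 `globalTwoRunSlackTail_of_chartsC` (= `GlobalSlackKernelMatching.globalTwoRunSlackTail_of_charts` with `LocBlockVolume` weakened to `LocBlockVolumeC … c`).
§2 **`K1aChartRowsC L 𝔠 a₀ a₁ a`** := `K1aChartRows` WITHOUT `L ≤ 𝔠.M₁`; `k1aChartRowsC_of_chartRows` (nothing proved for g0's rows is lost);
**`globalTwoRunSlackFam_of_k1aChartRowsC : (∀ L …, ∃ a, 0 < a ∧ a < 1 ∧ K1aChartRowsC L 𝔠 a₀ a₁ a) → ⟨REGISTERED 3⁗ TEXT VERBATIM⟩`**.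
§3 **`K1aChartRowsK L 𝔠 a₀ a₁ a`** := the six chart rows at the record's own decay rate `κ := 𝔠.κ` — NO letter on `𝔠` at all; `k1aChartRowsC_of_K`;
**`globalTwoRunSlackFam_of_k1aChartRowsK`**.  So the registered 3⁗ is, BY NAME and for EVERY constants record, the six chart rows of the K1a line at the canonical
polymerisation: `TaylorSplitΦ (canonPT p)`, K1a `FlatKernelCauchyΦ`, `KernelSizeΦ`, `RemainderSmallΦ`, `CfgSizeΦ`, `CfgCauchyΦ (ℓ ≡ 1)`.
Every `def` is a hypothesis schema; nothing of [Balaban1985UV3]/[King1986] is asserted.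

References: C. King, CMP 102 (1986) 649–677 [King1986] (Thm 3.4 (3.9) p.656, Prop. 3.6 p.662); T. Bałaban, CMP 102 (1985) 255–275 [Balaban1985UV3] ((24)–(25) p.262,
(28)–(30) p.263, (33)–(34) p.264, (43)–(46) pp.266–267, (57)–(61) pp.270–271); CMP 109 (1987) 249–301 [Balaban1987RG1] ((0.1) p.251, (0.26) p.257, (0.30) p.258).
-/

set_option autoImplicit false

noncomputable section

namespace Summit.QuantumFields.YangMills.Theorems.GlobalSlackCanonicalPolymers

open scoped BigOperators
open Literature.MathematicalPhysics.QuantumFieldTheory.Balaban1983to89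
open Literature.MathematicalPhysics.QuantumFieldTheory.Balaban1983to89.T3ContinuumYM3Torus
open Literature.MathematicalPhysics.QuantumFieldTheory.Balaban1983to89.T3UnitScaleTilt (θBal)
open Literature.MathematicalPhysics.QuantumFieldTheory.Balaban1983to89.T3AlphaInputsAC
open Literature.MathematicalPhysics.QuantumFieldTheory.Balaban1983to89.T3AlphaPolymerSocket
open Literature.MathematicalPhysics.QuantumFieldTheory.Balaban1983to89.T3AlphaInputsACTwoRun
open Literature.MathematicalPhysics.QuantumFieldTheory.Balaban1983to89.T3AlphaInputsACTwoRunLevel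
open Literature.MathematicalPhysics.QuantumFieldTheory.Balaban1983to89.B12TreeDecay (kappa₀ K₀ K₀_pos kappa₀_nonneg)
open Literature.MathematicalPhysics.QuantumFieldTheory.Balaban1985CMP102
open Literature.MathematicalPhysics.QuantumFieldTheory.Balaban1985CMP102.Setting
open Summit.QuantumFields.Balaban3D.Carriers
open Summit.QuantumFields.Balaban3D.Proofs.Primitives
open Summit.QuantumFields.Balaban3D.Proofs.GroupModelLieC (lieC)
open Summit.QuantumFields.YangMills.Theorems
open Summit.QuantumFields.YangMills.Theorems.GlobalSlack (GlobalSupRateTSlack)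
open Summit.QuantumFields.YangMills.Theorems.GlobalSlackKernelMatching
open Summit.QuantumFields.YangMills.Theorems.GlobalSlackLocalToGlobalCount (LocBlockVolumeC globalTwoRunSlackTail_of_polymerSlack_volC)

/-! ## §1 The K1a line end to end over the `c`-weighted volume row -/

section Abstract

variable {𝕍 : Type} [NormedAddCommGroup 𝕍] [NormedSpace ℂ 𝕍] {F : T3Family} {γ : ℝ}

/-- **THE K1a LINE END TO END OVER THE `c`-WEIGHTED VOLUME** (`GlobalSlackKernelMatching.globalTwoRunSlackTail_of_charts` with `LocBlockVolume D` weakened to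
`LocBlockVolumeC D c`): the six chart rows over one chart family and the five producer rows give `∃ σ₀ C₀, 7 ≤ σ₀ ∧ 0 ≤ C₀ ∧ GlobalSupRateTSlack D b₀ p₀ a σ₀ C₀`.
[cite: King1986, Thm 3.4 (3.9) p.656, Prop. 3.6 p.662; Balaban1985UV3, (24) p.262, (43)-(46) pp.266-267, (57) p.270] -/
theorem globalTwoRunSlackTail_of_chartsC {D : AlphaDataT3 F γ} {PT : TermFn F} {Φ : ChartFam 𝕍 F} {e : VacFam F} {B : CfgFam 𝕍 F} {R : RemFam F}
    {b₀ p₀ κ a C C_E C_R C_s C_B C_T C' c : ℝ}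
    (hγ : 0 < γ) (hγ1 : γ ≤ 1) (hγe : Real.sqrt γ ≤ Real.exp (1 - p₀)) (hb : 0 < b₀) (hp : 0 ≤ p₀) (ha : 0 < a) (ha1 : a < 1)
    (hC : 0 ≤ C) (hCE : 0 ≤ C_E) (hCR : 0 ≤ C_R) (hCs : 0 ≤ C_s) (hCB : 0 ≤ C_B) (hCT : 0 ≤ C_T)
    (hθ1 : ∀ n, (C_s + C_B) * θBal F.L γ b₀ p₀ n ≤ 1)
    (hdec : PintDecompTrivT D PT) (hLC : LocCover D κ C') (hBV : LocBlockVolumeC D c) (hLM : LocMatched D) (hTS : TermSizeTrivT D PT b₀ p₀ C_T κ)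
    (hT : TaylorSplitΦ PT Φ e B R) (hK : FlatKernelCauchyΦ D Φ κ a C) (hE : KernelSizeΦ D Φ κ C_E)
    (hR : RemainderSmallΦ D R b₀ p₀ κ C_R) (hS : CfgSizeΦ D B b₀ p₀ C_s) (hBC : CfgCauchyΦ D B b₀ p₀ a C_B fun _ => 1) :
    ∃ (σ₀ : ℕ) (C₀ : ℝ), 7 ≤ σ₀ ∧ 0 ≤ C₀ ∧ GlobalSupRateTSlack D b₀ p₀ a σ₀ C₀ := by
  have hL1 : (1 : ℝ) ≤ (F.L : ℝ) := by exact_mod_cast F.hL.2.le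
  have hθ0 : ∀ n, 0 ≤ θBal F.L γ b₀ p₀ n := fun n => (T3MinimiserStabilityReduction.θBal_pos F.hL.2.le hγ hγ1 hb p₀ n).le
  have hPC := polymerCauchyMinAtTSlack_of_charts hC hCE hCR hCs hCB hL1 hθ0 hθ1 hT hK hE hR hS hBC
  exact globalTwoRunSlackTail_of_polymerSlack_volC hγ hγ1 hγe hb hp ha ha1 (by positivity) hCT le_rfl
    hdec hLC hBV hLM hTS ((polymerCauchyMinAtTSlack_iff_localToGlobal D PT b₀ p₀ κ a 7 _).1 hPC)

end Abstract

/-! ## §2 The chart rows without the `L ≤ M₁` letter -/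

/-- **THE K1a CHART ROWS AT THE CANONICAL POLYMERISATION, NO `L ≤ M₁` LETTER** — g0's `K1aChartRows` (p538799) with the conjunct `L ≤ 𝔠.M₁` deleted and nothing
else changed: the located letters `0 < κ ≤ 𝔠.κ`, `κ₀(32,6) ≤ κ`, nonnegative constants, a threshold, and for every family / coupling / inhabited v3 package a coherent
family `p` with the given [7]-constants and ONE chart family with the SIX CHART ROWS at `dataOfV3 p (canonPolymer p)` / `canonPT p`.  Hypothesis schema; never
asserted. [cite: Balaban1985UV3, (25) p.262, (28)-(30) p.263, (33)-(34) p.264, (43)-(46) pp.266-267; King1986, Thm 3.4 (3.9) p.656, Prop. 3.6 (3.56) p.662] -/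
def K1aChartRowsC (L : ℕ) (𝔠 : AlphaConsts L (suGroupModel 2).N) (a₀ a₁ a : ℝ) : Prop :=
  ∃ (κ C C_E C_R C_s C_B γB : ℝ), 0 < κ ∧ κ ≤ 𝔠.κ ∧ kappa₀ (4 * 2 ^ 3) (2 * 3) ≤ κ ∧ 0 ≤ C ∧ 0 ≤ C_E ∧ 0 ≤ C_R ∧ 0 ≤ C_s ∧ 0 ≤ C_B ∧ 0 < γB ∧
    ∀ (F : T3Family) (γ : ℝ) (hF : F.L = L) (hγ : 0 < γ), γ ≤ γB → ∀ (hγ1 : γ ≤ (min (hF ▸ 𝔠).gamma0 1) ^ 2),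
      AlphaInputsT3AC.OfV3At F (hF ▸ 𝔠) a₀ a₁ →
        ∃ (p : ∀ K, AlphaInputsT3AC.PkgAtV3 F (hF ▸ 𝔠) γ hγ hγ1 K), (∀ K, (p K).a₀ = a₀ ∧ (p K).a₁ = a₁) ∧
          ∃ (Φ : ChartFam ↥(lieC (suGroupModel 2)) F) (e : VacFam F) (B : CfgFam ↥(lieC (suGroupModel 2)) F) (R : RemFam F),
            TaylorSplitΦ (canonPT p) Φ e B R ∧ FlatKernelCauchyΦ (AlphaInputsT3AC.dataOfV3 p (canonPolymer p)) Φ κ a C ∧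
            KernelSizeΦ (AlphaInputsT3AC.dataOfV3 p (canonPolymer p)) Φ κ C_E ∧
            RemainderSmallΦ (AlphaInputsT3AC.dataOfV3 p (canonPolymer p)) R (hF ▸ 𝔠).b₀ (hF ▸ 𝔠).p₀ κ C_R ∧
            CfgSizeΦ (AlphaInputsT3AC.dataOfV3 p (canonPolymer p)) B (hF ▸ 𝔠).b₀ (hF ▸ 𝔠).p₀ C_s ∧
            CfgCauchyΦ (AlphaInputsT3AC.dataOfV3 p (canonPolymer p)) B (hF ▸ 𝔠).b₀ (hF ▸ 𝔠).p₀ a C_B fun _ => 1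

/-- g0's rows (with the letter) give the letter-free rows: nothing proved for `K1aChartRows` is lost. [folklore] -/
theorem k1aChartRowsC_of_chartRows {L : ℕ} {𝔠 : AlphaConsts L (suGroupModel 2).N} {a₀ a₁ a : ℝ} (h : K1aChartRows L 𝔠 a₀ a₁ a) :
    K1aChartRowsC L 𝔠 a₀ a₁ a := by
  obtain ⟨κ, C, C_E, C_R, C_s, C_B, γB, hκ0, hκle, hκ₀, hC, hCE, hCR, hCs, hCB, hγB, -, hall⟩ := h
  exact ⟨κ, C, C_E, C_R, C_s, C_B, γB, hκ0, hκle, hκ₀, hC, hCE, hCR, hCs, hCB, hγB, hall⟩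

/-- **THE REGISTERED STUB 3⁗ FROM THE SIX CHART ROWS, NO LETTER ON `M₁`, BY NAME**: if for every odd `L ≥ 7`, every constants record and [7]-constants there is a rate
exponent `0 < a < 1` with `K1aChartRowsC L 𝔠 a₀ a₁ a`, then the text of `stub_globalTwoRunSlackFam` (skeleton v5k `Cruxes/FluctuationComparisonRegPrIntL/Lines/birth_v5k.lean`,
= v5j‴'s) holds VERBATIM — threshold `γB ⊓ gammaW ⊓ e^{2(1−p₀)}`, `σ = 7`; producer rows by `pintDecompTrivT_canon`, `locCover_canon`, the `volWeight`-volume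
(`…VolumeC`), `locMatched_canon`, `termSizeTrivT_canon'` (`…TermSizeC`); windows by `window_sum_le_one`/`window_jet`/`window_oldSlice`; composition by
`globalTwoRunSlackTail_of_chartsC`. [cite: King1986, Thm 3.4 (3.9) p.656, Prop. 3.6 p.662; Balaban1985UV3, (7) p.257, (24) p.262, (43)-(46) pp.266-267, (57) p.270] -/
theorem globalTwoRunSlackFam_of_k1aChartRowsC
    (h : ∀ (L : ℕ), Odd L → 7 ≤ L → ∀ (𝔠 : AlphaConsts L (suGroupModel 2).N) (a₀ a₁ : ℝ), 0 < a₀ → 0 < a₁ → 𝔠.B₃ * a₁ ≤ a₀ →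
      ∃ a : ℝ, 0 < a ∧ a < 1 ∧ K1aChartRowsC L 𝔠 a₀ a₁ a) :
    ∀ (L : ℕ), Odd L → 7 ≤ L → ∀ (𝔠 : Summit.QuantumFields.Balaban3D.Proofs.Primitives.AlphaConsts L (Summit.QuantumFields.Balaban3D.Carriers.suGroupModel 2).N)
      (a₀ a₁ : ℝ), 0 < a₀ → 0 < a₁ → 𝔠.B₃ * a₁ ≤ a₀ →
      ∃ a : ℝ, 0 < a ∧ ∃ γB : ℝ, 0 < γB ∧ ∀ (F : T3Family) (γ : ℝ) (hF : F.L = L) (hγ : 0 < γ), γ ≤ γB →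
        ∀ (hγ1 : γ ≤ (min (hF ▸ 𝔠).gamma0 1) ^ 2),
          Summit.QuantumFields.YangMills.Theorems.AlphaInputsT3AC.OfV3At F (hF ▸ 𝔠) a₀ a₁ →
          ∃ (p : ∀ K, Summit.QuantumFields.YangMills.Theorems.AlphaInputsT3AC.PkgAtV3 F (hF ▸ 𝔠) γ hγ hγ1 K),
            (∀ K, (p K).a₀ = a₀ ∧ (p K).a₁ = a₁) ∧
            ∃ (π : Summit.QuantumFields.YangMills.Theorems.AlphaInputsT3AC.PolymerT3 F) (σ : ℕ) (C : ℝ), 7 ≤ σ ∧ 0 ≤ C ∧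
              Summit.QuantumFields.YangMills.Theorems.GlobalSlack.GlobalSupRateTSlack (Summit.QuantumFields.YangMills.Theorems.AlphaInputsT3AC.dataOfV3 p π) (hF ▸ 𝔠).b₀ (hF ▸ 𝔠).p₀ a σ C := by
  intro L hLo h7 𝔠 a₀ a₁ ha0 ha1 hw
  obtain ⟨a, ha, ha1', κ, C, C_E, C_R, C_s, C_B, γB, hκ0, hκle, hκ₀, hC, hCE, hCR, hCs, hCB, hγB, hall⟩ := h L hLo h7 𝔠 a₀ a₁ ha0 ha1 hw
  refine ⟨a, ha, min γB (min (gammaW L 𝔠 C_s C_B) (Real.exp (2 * (1 - 𝔠.p₀)))),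
    lt_min hγB (lt_min (gammaW_pos L 𝔠 C_s C_B) (Real.exp_pos _)), fun F γ hF hγ hγle hγ1 hOf => ?_⟩
  subst hF
  have hγB' : γ ≤ γB := hγle.trans (min_le_left _ _)
  have hW : γ ≤ gammaW F.L 𝔠 C_s C_B := hγle.trans ((min_le_right _ _).trans (min_le_left _ _))
  have hγe : Real.sqrt γ ≤ Real.exp (1 - 𝔠.p₀) := sqrt_le_exp_of_le (hγle.trans ((min_le_right _ _).trans (min_le_right _ _)))
  have h0 : γ ≤ gammaθ 𝔠.b₀ 𝔠.p₀ (1 / max 1 (C_s + C_B)) := hW.trans (min_le_left _ _)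
  have h1 : γ ≤ gammaθ 𝔠.b₀ (𝔠.p₀ + 𝔠.r₀) (𝔠.ρ / (4 * max 1 𝔠.cB)) := hW.trans ((min_le_right _ _).trans (min_le_left _ _))
  have h2 : γ ≤ gammaθ 𝔠.b₀ 𝔠.p₀ (1 / (2 * (8 * ((F.L : ℝ) + 1) ^ 2 * 𝔠.B₃ * 𝔠.Zfull))) := hW.trans ((min_le_right _ _).trans (min_le_right _ _))
  have hγ1' : γ ≤ 1 := hγ1.trans (sq_min_one_le _ 𝔠.gamma0_pos)
  obtain ⟨p, hp, Φ, e, B, R, hT, hK, hE, hR, hS, hBC⟩ := hall F γ rfl hγ hγB' hγ1 hOf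
  have hwin : ∀ n, (C_s + C_B) * θBal F.L γ 𝔠.b₀ 𝔠.p₀ n ≤ 1 := fun n => window_sum_le_one F.hL.2.le 𝔠.b₀_pos 𝔠.p₀_pos hγ hγ1' h0 n
  have hw1 := fun K k hk => window_jet (hγ := hγ) (hγ1 := hγ1) h1 K k hk
  have hw2 := fun K k hk => window_oldSlice (hγ := hγ) (hγ1 := hγ1) h2 K k hk
  have hBV : LocBlockVolumeC (AlphaInputsT3AC.dataOfV3 p (canonPolymer p)) (volWeight F.L 𝔠.M₁) :=
    ⟨volWeight_canon_pos 𝔠, fun K j hh i Y hY => volWeight_mul_pow_le_sum_indicator_canon p K j hh i Y hY⟩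
  have hCT : 0 ≤ max (newConst 𝔠) (oldConst 𝔠 * (F.L : ℝ) ^ 4 * Real.exp (κ * (F.L : ℝ) ^ 3)) := le_max_of_le_left (newConst_nonneg 𝔠)
  obtain ⟨σ, C₀, hσ, hC₀, hG⟩ := globalTwoRunSlackTail_of_chartsC hγ hγ1' hγe 𝔠.b₀_pos 𝔠.p₀_pos.le ha ha1' hC hCE hCR hCs hCB hCT
    hwin (pintDecompTrivT_canon p) (locCover_canon p hκ0.le hκ₀) hBV (locMatched_canon p) (termSizeTrivT_canon' p hκ0 hκle hw1 hw2)
    hT hK hE hR hS hBC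
  exact ⟨p, hp, canonPolymer p, σ, C₀, hσ, hC₀, hG⟩

/-! ## §3 The chart rows at the record's own decay rate: no letter on the record at all -/

/-- **THE K1a CHART ROWS AT THE RECORD'S DECAY RATE `κ := 𝔠.κ`** — `K1aChartRowsC` with the decay rate pinned to the record's chart decay (admissible by
`AlphaConsts.kappa_ge : κ₀(32,6) + 1 ≤ 𝔠.κ`): nonnegative constants, a threshold, and for every family / coupling / inhabited v3 package a coherent family `p` with
the given [7]-constants and ONE chart family with the SIX CHART ROWS at `dataOfV3 p (canonPolymer p)` / `canonPT p`, decay `𝔠.κ`.  NO condition on `𝔠`.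
Hypothesis schema; never asserted. [cite: Balaban1985UV3, (25) p.262, (28)-(30) p.263, (33)-(34) p.264, (43)-(46) pp.266-267; King1986, Thm 3.4 (3.9) p.656, Prop. 3.6 (3.56) p.662] -/
def K1aChartRowsK (L : ℕ) (𝔠 : AlphaConsts L (suGroupModel 2).N) (a₀ a₁ a : ℝ) : Prop :=
  ∃ (C C_E C_R C_s C_B γB : ℝ), 0 ≤ C ∧ 0 ≤ C_E ∧ 0 ≤ C_R ∧ 0 ≤ C_s ∧ 0 ≤ C_B ∧ 0 < γB ∧
    ∀ (F : T3Family) (γ : ℝ) (hF : F.L = L) (hγ : 0 < γ), γ ≤ γB → ∀ (hγ1 : γ ≤ (min (hF ▸ 𝔠).gamma0 1) ^ 2),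
      AlphaInputsT3AC.OfV3At F (hF ▸ 𝔠) a₀ a₁ →
        ∃ (p : ∀ K, AlphaInputsT3AC.PkgAtV3 F (hF ▸ 𝔠) γ hγ hγ1 K), (∀ K, (p K).a₀ = a₀ ∧ (p K).a₁ = a₁) ∧
          ∃ (Φ : ChartFam ↥(lieC (suGroupModel 2)) F) (e : VacFam F) (B : CfgFam ↥(lieC (suGroupModel 2)) F) (R : RemFam F),
            TaylorSplitΦ (canonPT p) Φ e B R ∧ FlatKernelCauchyΦ (AlphaInputsT3AC.dataOfV3 p (canonPolymer p)) Φ (hF ▸ 𝔠).κ a C ∧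
            KernelSizeΦ (AlphaInputsT3AC.dataOfV3 p (canonPolymer p)) Φ (hF ▸ 𝔠).κ C_E ∧
            RemainderSmallΦ (AlphaInputsT3AC.dataOfV3 p (canonPolymer p)) R (hF ▸ 𝔠).b₀ (hF ▸ 𝔠).p₀ (hF ▸ 𝔠).κ C_R ∧
            CfgSizeΦ (AlphaInputsT3AC.dataOfV3 p (canonPolymer p)) B (hF ▸ 𝔠).b₀ (hF ▸ 𝔠).p₀ C_s ∧
            CfgCauchyΦ (AlphaInputsT3AC.dataOfV3 p (canonPolymer p)) B (hF ▸ 𝔠).b₀ (hF ▸ 𝔠).p₀ a C_B fun _ => 1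

/-- The record's decay rate is admissible for the cover row: `0 < 𝔠.κ` and `κ₀(32,6) ≤ 𝔠.κ` (`AlphaConsts.kappa_ge`, `kappa₀ ≥ 0`). [cite: Balaban1987RG1, (0.26) p.257] -/
theorem kappa_record_admissible {L : ℕ} (𝔠 : AlphaConsts L (suGroupModel 2).N) :
    0 < 𝔠.κ ∧ kappa₀ (4 * 2 ^ 3) (2 * 3) ≤ 𝔠.κ := by
  have h := 𝔠.kappa_ge
  have h0 : 0 ≤ kappa₀ (4 * 2 ^ 3) (2 * 3) := kappa₀_nonneg (by norm_num) _
  exact ⟨by linarith, by linarith⟩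

/-- The rows at the record's decay rate give the letter-free rows (`κ := 𝔠.κ`). [folklore] -/
theorem k1aChartRowsC_of_K {L : ℕ} {𝔠 : AlphaConsts L (suGroupModel 2).N} {a₀ a₁ a : ℝ} (h : K1aChartRowsK L 𝔠 a₀ a₁ a) :
    K1aChartRowsC L 𝔠 a₀ a₁ a := by
  obtain ⟨C, C_E, C_R, C_s, C_B, γB, hC, hCE, hCR, hCs, hCB, hγB, hall⟩ := h
  obtain ⟨hκ0, hκ₀⟩ := kappa_record_admissible 𝔠
  refine ⟨𝔠.κ, C, C_E, C_R, C_s, C_B, γB, hκ0, le_rfl, hκ₀, hC, hCE, hCR, hCs, hCB, hγB, fun F γ hF hγ hγle hγ1 hOf => ?_⟩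
  subst hF
  exact hall F γ rfl hγ hγle hγ1 hOf

/-- **THE REGISTERED STUB 3⁗ FROM THE SIX CHART ROWS AT THE RECORD'S DECAY RATE — NO LETTER ON THE RECORD, BY NAME**
(`globalTwoRunSlackFam_of_k1aChartRowsC ∘ k1aChartRowsC_of_K`). [cite: King1986, Thm 3.4 (3.9) p.656, Prop. 3.6 p.662; Balaban1985UV3, (7) p.257, (43)-(46) pp.266-267, (57) p.270] -/
theorem globalTwoRunSlackFam_of_k1aChartRowsK
    (h : ∀ (L : ℕ), Odd L → 7 ≤ L → ∀ (𝔠 : AlphaConsts L (suGroupModel 2).N) (a₀ a₁ : ℝ), 0 < a₀ → 0 < a₁ → 𝔠.B₃ * a₁ ≤ a₀ →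
      ∃ a : ℝ, 0 < a ∧ a < 1 ∧ K1aChartRowsK L 𝔠 a₀ a₁ a) :
    ∀ (L : ℕ), Odd L → 7 ≤ L → ∀ (𝔠 : Summit.QuantumFields.Balaban3D.Proofs.Primitives.AlphaConsts L (Summit.QuantumFields.Balaban3D.Carriers.suGroupModel 2).N)
      (a₀ a₁ : ℝ), 0 < a₀ → 0 < a₁ → 𝔠.B₃ * a₁ ≤ a₀ →
      ∃ a : ℝ, 0 < a ∧ ∃ γB : ℝ, 0 < γB ∧ ∀ (F : T3Family) (γ : ℝ) (hF : F.L = L) (hγ : 0 < γ), γ ≤ γB →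
        ∀ (hγ1 : γ ≤ (min (hF ▸ 𝔠).gamma0 1) ^ 2),
          Summit.QuantumFields.YangMills.Theorems.AlphaInputsT3AC.OfV3At F (hF ▸ 𝔠) a₀ a₁ →
          ∃ (p : ∀ K, Summit.QuantumFields.YangMills.Theorems.AlphaInputsT3AC.PkgAtV3 F (hF ▸ 𝔠) γ hγ hγ1 K),
            (∀ K, (p K).a₀ = a₀ ∧ (p K).a₁ = a₁) ∧
            ∃ (π : Summit.QuantumFields.YangMills.Theorems.AlphaInputsT3AC.PolymerT3 F) (σ : ℕ) (C : ℝ), 7 ≤ σ ∧ 0 ≤ C ∧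
              Summit.QuantumFields.YangMills.Theorems.GlobalSlack.GlobalSupRateTSlack (Summit.QuantumFields.YangMills.Theorems.AlphaInputsT3AC.dataOfV3 p π) (hF ▸ 𝔠).b₀ (hF ▸ 𝔠).p₀ a σ C :=
  globalTwoRunSlackFam_of_k1aChartRowsC fun L hLo h7 𝔠 a₀ a₁ ha0 ha1 hw => by
    obtain ⟨a, ha, ha1', hc⟩ := h L hLo h7 𝔠 a₀ a₁ ha0 ha1 hw
    exact ⟨a, ha, ha1', k1aChartRowsC_of_K hc⟩

/-- g0's route (letters `L ≤ M₁`, `κ`) is a special case of the letter-free one (for the record: both capstones now conclude 3⁗ BY NAME). [folklore] -/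
theorem globalTwoRunSlackFam_of_k1aChartRows'
    (h : ∀ (L : ℕ), Odd L → 7 ≤ L → ∀ (𝔠 : AlphaConsts L (suGroupModel 2).N) (a₀ a₁ : ℝ), 0 < a₀ → 0 < a₁ → 𝔠.B₃ * a₁ ≤ a₀ →
      ∃ a : ℝ, 0 < a ∧ a < 1 ∧ K1aChartRows L 𝔠 a₀ a₁ a) :
    ∀ (L : ℕ), Odd L → 7 ≤ L → ∀ (𝔠 : Summit.QuantumFields.Balaban3D.Proofs.Primitives.AlphaConsts L (Summit.QuantumFields.Balaban3D.Carriers.suGroupModel 2).N)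
      (a₀ a₁ : ℝ), 0 < a₀ → 0 < a₁ → 𝔠.B₃ * a₁ ≤ a₀ →
      ∃ a : ℝ, 0 < a ∧ ∃ γB : ℝ, 0 < γB ∧ ∀ (F : T3Family) (γ : ℝ) (hF : F.L = L) (hγ : 0 < γ), γ ≤ γB →
        ∀ (hγ1 : γ ≤ (min (hF ▸ 𝔠).gamma0 1) ^ 2),
          Summit.QuantumFields.YangMills.Theorems.AlphaInputsT3AC.OfV3At F (hF ▸ 𝔠) a₀ a₁ →
          ∃ (p : ∀ K, Summit.QuantumFields.YangMills.Theorems.AlphaInputsT3AC.PkgAtV3 F (hF ▸ 𝔠) γ hγ hγ1 K),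
            (∀ K, (p K).a₀ = a₀ ∧ (p K).a₁ = a₁) ∧
            ∃ (π : Summit.QuantumFields.YangMills.Theorems.AlphaInputsT3AC.PolymerT3 F) (σ : ℕ) (C : ℝ), 7 ≤ σ ∧ 0 ≤ C ∧
              Summit.QuantumFields.YangMills.Theorems.GlobalSlack.GlobalSupRateTSlack (Summit.QuantumFields.YangMills.Theorems.AlphaInputsT3AC.dataOfV3 p π) (hF ▸ 𝔠).b₀ (hF ▸ 𝔠).p₀ a σ C :=
  globalTwoRunSlackFam_of_k1aChartRowsC fun L hLo h7 𝔠 a₀ a₁ ha0 ha1 hw => by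
    obtain ⟨a, ha, ha1', hc⟩ := h L hLo h7 𝔠 a₀ a₁ ha0 ha1 hw
    exact ⟨a, ha, ha1', k1aChartRowsC_of_chartRows hc⟩

end Summit.QuantumFields.YangMills.Theorems.GlobalSlackCanonicalPolymers

end
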